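import Literature.NumberTheory.LFunctions.Zhang2022.DetectorShiftAfeOrthogonality

/-!
# Zhang (2022), programme F-S3 (cell landau-siegel §E, seat ls-barrier-p6, row S-E-p6-5): the one-sided recipe form
# in CLOSED FORM on Euler–Lagrange profiles, and the NULL PROFILE on every lattice edge `b = (t; k, k+1)`

Y. Zhang, *Discrete mean estimates and the Landau–Siegel zero*, arXiv:2211.02515v1 [Zhang2022LandauSiegel] —
an unrefereed manuscript under adjudication. **WHAT THIS IS NOT: not a claim about Theorems 1–2 of
arXiv:2211.02515, about Landau–Siegel zeros, or about Parity; nothing here asserts any claim of the manuscript.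
The programme SEARCHES and TYPES; no claim about Landau–Siegel zeros, Theorems 1–2 of arXiv:2211.02515 or a
repaired Margin232 until a kernel theorem says so.**

Part 1 (general, any distinct real triple `b`). For a one-sided `C²` profile `h` (`h(1) = 0`) whose Euler–Lagrange
image `Λ_b h = −h″ − iπe₁h′ + π²e₂h + iπ³e₃∫₀ˣh` is a CONSTANT `C` on `[0,1]` — every one-sided AFE exponential sum is
such a profile (`Det.el_afeSum_const`) — the core form and the recipe form are BOUNDARY DATA:
`Q_e(h,h) = C·conj ∫h − h′(0)·conj h(0) − iπe₁|h(0)|²` (`shiftCore_self_of_el`, two integrations by parts), hence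
`π·M_b(h,h) = m₀·[C·conj∫h − h′(0)conj h(0) − iπe₁|h(0)|²] + iπm_s|h(0)|² − π²m_n h(0)conj∫h`
(`mformDet_self_shiftRecipe_of_el`, via the collapse `DetectorRecipeCollapse`) — the closed form of the one-sided
form on the AFE plane («G-route» of the cell's SHIFT-PSD.md §0.3) as a kernel identity.

Part 2 (the lattice edge). For `b = (t; k, k+1)` with `k ∈ ℕ`, `k ≥ 1`, `t ∉ {0, k, k+1}` and the one-sided AFE PAIR
`h(y) = e^{−iπky} + e^{−iπ(k+1)y}` (`h(1) = 0`): **`𝔅_{R(b)}(h) = 0`** (`formDet_shiftRecipe_edge_afePair`) — for EVERY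
real `t`, i.e. on the whole edge `{b₁ = k, b₂ = k+1}` of the gap-`k` cell of `Det.SignAdmissible` (and beyond it), the
displayed slot `Det.FormDetPSD (Det.shiftRecipe b)` (E-010) has a non-trivial NULL profile: it can hold there only with
a kernel, never with a margin (`exists_nullProfile_edge`). This is the edge case of the cell's kernel-dimension law
(ls-theory 2026-08-27T01:39Z; barrier/num/H-CLOSED-FORM.md §10: under doubling the pair's Fourier support lies on the
zero set of the lattice symbol) proved directly: with `u = e^{iπt/2}` every ingredient is `i·(real)`, and the identity
reduces to ONE rational identity in `(t, k, π)` per parity of `k` (`ring`). Numerics that located it: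
barrier/p6/resonant/nullvec.py (cell note RESONANT-PLANE.md §2). Elementary; standard axioms; no definitions.

References: Y. Zhang, arXiv:2211.02515v1 (2022), §2 Lemma 2.3, (2.13); Prop. 7.1 p. 44 with (7.19)–(7.21),
§8 (8.11)–(8.23). [cite: Zhang2022LandauSiegel, Prop 7.1 p. 44, (8.11)–(8.12)]
-/

noncomputable section

open Complex Real ComplexConjugate Set intervalIntegral
open _root_.MeasureTheory

namespace Literature.NumberTheory.LFunctions.Zhang2022

namespace Det

open Repair

variable {g g' h h' h'' : ℝ → ℂ}

/-! ### Calculus helpers (local copies) -/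

/-- A `C¹` profile is a kinked profile. [folklore] -/
private theorem kinkedProfile_of_isC1' (hg : IsC1OnUnitInterval g g') : KinkedProfile g g' :=
  ⟨hg.cont, fun x hx => (hg.hasDeriv x hx).hasDerivWithinAt, hg.isH1.memLp⟩

/-- The primitive `x ↦ ∫₀ˣ h` of a continuous `h` has derivative `h(x)` at interior points. [folklore] -/
private theorem hasDerivAt_primitive_unit'' (hh : ContinuousOn h (Icc 0 1)) {x : ℝ} (hx : x ∈ Ioo (0:ℝ) 1) :
    HasDerivAt (fun y => ∫ t in (0:ℝ)..y, h t) (h x) x := by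
  have hint : IntervalIntegrable h volume 0 x :=
    (hh.mono (Icc_subset_Icc_right hx.2.le)).intervalIntegrable_of_Icc hx.1.le
  have hmeas : StronglyMeasurableAtFilter h (nhds x) volume :=
    ContinuousOn.stronglyMeasurableAtFilter isOpen_Ioo (hh.mono Ioo_subset_Icc_self) x hx
  have hcont : ContinuousAt h x := hh.continuousAt (Icc_mem_nhds hx.1 hx.2)
  exact intervalIntegral.integral_hasDerivAt_right hint hmeas hcont

/-- The primitive of a kinked profile is a kinked profile with that derivative. [folklore] -/
private theorem kinkedProfile_primitive' (hh : KinkedProfile h h') :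
    KinkedProfile (fun x => ∫ t in (0:ℝ)..x, h t) h :=
  kinkedProfile_of_isC1' ⟨continuousOn_primitive_unit hh.cont, hh.cont,
    fun _ hx => hasDerivAt_primitive_unit'' hh.cont hx⟩

/-- `⟨c, g⟩ = c · conj ∫ g` for a constant `c`. [folklore] -/
private theorem integral_const_mul_conj' (g : ℝ → ℂ) (c : ℂ) :
    (∫ x in (0:ℝ)..1, c * conj (g x)) = c * conj (∫ x in (0:ℝ)..1, g x) := by
  rw [intervalIntegral.integral_const_mul]
  congr 1
  simp only [intervalIntegral, map_sub, integral_conj]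

/-! ### Part 1 — the core form and `M_b` of a one-sided Euler–Lagrange profile are boundary data -/

/-- **`Q_e(h,h)` for a one-sided Euler–Lagrange profile:** if `h` is `C²` with `h(1) = 0` and
`−h″ − iπe₁h′ + π²e₂h + iπ³e₃∫₀ˣh = C` on `[0,1]`, then
`shiftCore e₁ e₂ e₃ h h′ h h′ = C·conj(∫₀¹h) − h′(0)·conj h(0) − iπe₁·h(0)·conj h(0)`.
[cite: Zhang2022LandauSiegel, Prop 7.1 p. 44, (8.11)–(8.12)] -/
theorem shiftCore_self_of_el {e1 e2 e3 : ℝ} {C : ℂ} (hh : IsC1OnUnitInterval h h') (hh' : IsC1OnUnitInterval h' h'')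
    (hh1 : h 1 = 0)
    (hel : ∀ x ∈ Icc (0:ℝ) 1,
      -h'' x - I * π * e1 * h' x + (π : ℂ) ^ 2 * e2 * h x + I * (π : ℂ) ^ 3 * e3 * ∫ t in (0:ℝ)..x, h t = C) :
    shiftCore e1 e2 e3 h h' h h'
      = C * conj (∫ x in (0:ℝ)..1, h x) - h' 0 * conj (h 0) - I * π * e1 * (h 0 * conj (h 0)) := by
  have hhk := kinkedProfile_of_isC1' hh
  have hh'k := kinkedProfile_of_isC1' hh'
  -- ⟨h′,h′⟩ = −⟨h″,h⟩ − h′(0)·conj h(0)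
  have ibp1 := integral_deriv_mul_conj_add hh'k hhk
  simp only [hh1, map_zero, mul_zero, zero_sub] at ibp1
  -- ⟨h,h′⟩ = −⟨h′,h⟩ − h(0)·conj h(0)
  have ibp2 := integral_deriv_mul_conj_add hhk hhk
  simp only [hh1, map_zero, mul_zero, zero_sub] at ibp2
  -- |∫h|² − ⟨h,S_h⟩ = ⟨S_h,h⟩
  have ibp3 := integral_deriv_mul_conj_add (kinkedProfile_primitive' hhk) (kinkedProfile_primitive' hhk)
  simp only [intervalIntegral.integral_same, map_zero, mul_zero, sub_zero] at ibp3
  have hA : (∫ x in (0:ℝ)..1, h' x * conj (h' x))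
      = -(∫ x in (0:ℝ)..1, h'' x * conj (h x)) - h' 0 * conj (h 0) := by linear_combination ibp1
  have hB : (∫ x in (0:ℝ)..1, h x * conj (h' x))
      = -(∫ x in (0:ℝ)..1, h' x * conj (h x)) - h 0 * conj (h 0) := by linear_combination ibp2
  have hD : (∫ x in (0:ℝ)..1, h x) * conj (∫ x in (0:ℝ)..1, h x)
        - (∫ x in (0:ℝ)..1, h x * conj (∫ t in (0:ℝ)..x, h t))
      = ∫ x in (0:ℝ)..1, (∫ t in (0:ℝ)..x, h t) * conj (h x) := by linear_combination (-1 : ℂ) * ibp3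
  unfold shiftCore
  rw [hA, hB, hD]
  -- the bulk combination is ⟨Λh, h⟩ = C·conj ∫h
  have hS : ContinuousOn (fun x => ∫ t in (0:ℝ)..x, h t) (Icc 0 1) := continuousOn_primitive_unit hh.cont
  have ci : ∀ {F : ℝ → ℂ}, ContinuousOn F (Icc 0 1) →
      IntervalIntegrable (fun x => F x * conj (h x)) volume 0 1 := fun hF =>
    (hF.mul (continuousOn_conj_comp hh.cont)).intervalIntegrable_of_Icc zero_le_one
  have i2 := ci hh'.cont'
  have i2n : IntervalIntegrable (fun x => -(h'' x * conj (h x))) volume 0 1 := i2.neg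
  have i1 := ci hh.cont'
  have i1n : IntervalIntegrable (fun x => -(h' x * conj (h x))) volume 0 1 := i1.neg
  have i0 := ci hh.cont
  have iS := ci hS
  have key : (∫ x in (0:ℝ)..1, C * conj (h x))
      = -(∫ x in (0:ℝ)..1, h'' x * conj (h x)) + I * π * e1 * (-(∫ x in (0:ℝ)..1, h' x * conj (h x)))
        + (π : ℂ) ^ 2 * e2 * (∫ x in (0:ℝ)..1, h x * conj (h x))
        + I * (π : ℂ) ^ 3 * e3 * (∫ x in (0:ℝ)..1, (∫ t in (0:ℝ)..x, h t) * conj (h x)) := by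
    have hcongr : (∫ x in (0:ℝ)..1, C * conj (h x))
        = ∫ x in (0:ℝ)..1, (((-(h'' x * conj (h x)) + I * π * e1 * (-(h' x * conj (h x))))
            + (π : ℂ) ^ 2 * e2 * (h x * conj (h x)))
            + I * (π : ℂ) ^ 3 * e3 * ((∫ t in (0:ℝ)..x, h t) * conj (h x))) := by
      refine intervalIntegral.integral_congr fun x hx => ?_
      rw [uIcc_of_le zero_le_one] at hx
      rw [← hel x hx]
      ring
    rw [hcongr, intervalIntegral.integral_add ((i2n.add (i1n.const_mul _)).add (i0.const_mul _))
        (iS.const_mul _), intervalIntegral.integral_add (i2n.add (i1n.const_mul _)) (i0.const_mul _),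
      intervalIntegral.integral_add i2n (i1n.const_mul _), intervalIntegral.integral_neg,
      intervalIntegral.integral_const_mul, intervalIntegral.integral_neg, intervalIntegral.integral_const_mul,
      intervalIntegral.integral_const_mul]
  rw [integral_const_mul_conj'] at key
  linear_combination -key

variable {b : Fin 3 → ℝ}

/-- **`M_b(h,h)` of a one-sided Euler–Lagrange profile is boundary data** (distinct triple `b`, `e_k = symE_k b`):
`M_b(h,h) = (1/π)·(m₀·[C·conj∫h − h′(0)conj h(0) − iπe₁ h(0)conj h(0)] + iπ·m_s·h(0)conj h(0) − π²·m_n·h(0)·conj∫h)`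
with the dd-moments `m₀ = ddM0 b`, `m_s = ddMs b`, `m_n = ddMn b` (equal to the recipe's channel sums for distinct `b`,
`Det.sum_shiftW_eq_ddM0` etc.). [cite: Zhang2022LandauSiegel, Prop 7.1 p. 44, (8.11)–(8.12)] -/
theorem mformDet_self_shiftRecipe_of_el {C : ℂ} (hb : Function.Injective b) (hh : IsC1OnUnitInterval h h')
    (hh' : IsC1OnUnitInterval h' h'') (hh1 : h 1 = 0)
    (hel : ∀ x ∈ Icc (0:ℝ) 1,
      -h'' x - I * π * (symE1 b) * h' x + (π : ℂ) ^ 2 * (symE2 b) * h x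
        + I * (π : ℂ) ^ 3 * (symE3 b) * ∫ t in (0:ℝ)..x, h t = C) :
    MformDet (shiftRecipe b) h h' h h'
      = (((1 / π : ℝ)) : ℂ) *
        (ddM0 b * (C * conj (∫ x in (0:ℝ)..1, h x) - h' 0 * conj (h 0) - I * π * (symE1 b) * (h 0 * conj (h 0)))
          + I * π * (ddMs b * (h 0 * conj (h 0)))
          - (π : ℂ) ^ 2 * (ddMn b * (h 0 * conj (∫ x in (0:ℝ)..1, h x)))) := by
  have hhk := kinkedProfile_of_isC1' hh
  rw [← mformDD_eq_mformDet hb hhk hhk hh1, mformDD_eq_collapse_oneSided b hhk hhk hh1,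
    shiftCore_self_of_el hh hh' hh1 hel]

/-- … hence **`𝔅_b(h) = 2·Re M_b(h,h)`** with that closed form (`Det.formDet_eq_two_mul_re`).
[cite: Zhang2022LandauSiegel, Prop 7.1 p. 44, (8.11)–(8.12)] -/
theorem formDet_shiftRecipe_of_el {C : ℂ} (hb : Function.Injective b) (hh : IsC1OnUnitInterval h h')
    (hh' : IsC1OnUnitInterval h' h'') (hh1 : h 1 = 0)
    (hel : ∀ x ∈ Icc (0:ℝ) 1,
      -h'' x - I * π * (symE1 b) * h' x + (π : ℂ) ^ 2 * (symE2 b) * h x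
        + I * (π : ℂ) ^ 3 * (symE3 b) * ∫ t in (0:ℝ)..x, h t = C) :
    FormDet (shiftRecipe b) h h'
      = 2 * ((((1 / π : ℝ)) : ℂ) *
        (ddM0 b * (C * conj (∫ x in (0:ℝ)..1, h x) - h' 0 * conj (h 0) - I * π * (symE1 b) * (h 0 * conj (h 0)))
          + I * π * (ddMs b * (h 0 * conj (h 0)))
          - (π : ℂ) ^ 2 * (ddMn b * (h 0 * conj (∫ x in (0:ℝ)..1, h x))))).re := by
  rw [formDet_eq_two_mul_re, mformDet_self_shiftRecipe_of_el hb hh hh' hh1 hel]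

/-! ### Part 2 — the lattice edge `b = (t; k, k+1)` and the AFE pair `e^{−iπky} + e^{−iπ(k+1)y}` -/

section Edge

/-- Derivative of `y ↦ e^{cy}`. [folklore] -/
private theorem hasDerivAt_cexp_mul' (c : ℂ) (y : ℝ) :
    HasDerivAt (fun y : ℝ => cexp (c * y)) (c * cexp (c * y)) y := by
  have h1 : HasDerivAt (fun y : ℝ => c * (y : ℂ)) c y := by
    simpa using ((hasDerivAt_id y).ofReal_comp).const_mul c
  exact ((Complex.hasDerivAt_exp _).comp y h1).congr_deriv (by ring)

/-- The AFE pair with its derivatives: `p_j(y) = c₁^j e^{c₁y} + c₂^j e^{c₂y}`, `p_j′ = p_{j+1}`. [folklore] -/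
private theorem hasDerivAt_pair (c₁ c₂ : ℂ) (j : ℕ) (y : ℝ) :
    HasDerivAt (fun y : ℝ => c₁ ^ j * cexp (c₁ * y) + c₂ ^ j * cexp (c₂ * y))
      (c₁ ^ (j + 1) * cexp (c₁ * y) + c₂ ^ (j + 1) * cexp (c₂ * y)) y := by
  have h := ((hasDerivAt_cexp_mul' c₁ y).const_mul (c₁ ^ j)).add ((hasDerivAt_cexp_mul' c₂ y).const_mul (c₂ ^ j))
  exact h.congr_deriv (by ring)

/-- Continuity of the pair. [folklore] -/
private theorem continuous_pair (c₁ c₂ : ℂ) (j : ℕ) :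
    Continuous (fun y : ℝ => c₁ ^ j * cexp (c₁ * y) + c₂ ^ j * cexp (c₂ * y)) :=
  (continuous_const.mul (Complex.continuous_exp.comp (continuous_const.mul Complex.continuous_ofReal))).add
    (continuous_const.mul (Complex.continuous_exp.comp (continuous_const.mul Complex.continuous_ofReal)))

/-- The pair is `C¹` on `[0,1]` (each derivative order). [folklore] -/
private theorem isC1_pair (c₁ c₂ : ℂ) (j : ℕ) :
    IsC1OnUnitInterval (fun y : ℝ => c₁ ^ j * cexp (c₁ * y) + c₂ ^ j * cexp (c₂ * y))
      (fun y : ℝ => c₁ ^ (j + 1) * cexp (c₁ * y) + c₂ ^ (j + 1) * cexp (c₂ * y)) :=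
  ⟨(continuous_pair c₁ c₂ j).continuousOn, (continuous_pair c₁ c₂ (j + 1)).continuousOn,
    fun y _ => hasDerivAt_pair c₁ c₂ j y⟩

/-- `e^{−iπk} = (−1)^k` for `k ∈ ℕ`. [folklore] -/
private theorem cexp_neg_I_pi_nat (k : ℕ) : cexp (-(I * π * k)) = (((-1 : ℝ) ^ k : ℝ) : ℂ) := by
  rw [show -(I * π * (k : ℂ)) = (k : ℂ) * (-(π * I)) by ring, Complex.exp_nat_mul, Complex.exp_neg,
    Complex.exp_pi_mul_I]
  push_cast
  norm_num

/-- `e^{iπk} = (−1)^k` for `k ∈ ℕ`. [folklore] -/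
private theorem cexp_I_pi_nat (k : ℕ) : cexp (I * π * k) = (((-1 : ℝ) ^ k : ℝ) : ℂ) := by
  rw [show I * π * (k : ℂ) = (k : ℂ) * (π * I) by ring, Complex.exp_nat_mul, Complex.exp_pi_mul_I]
  push_cast
  ring

/-- `e^{iπ/2} = i`. [folklore] -/
private theorem cexp_I_pi_half : cexp (I * π * (1 / 2 : ℂ)) = I := by
  rw [show I * π * (1 / 2 : ℂ) = ((π / 2 : ℝ) : ℂ) * I by push_cast; ring, Complex.exp_mul_I,
    ← Complex.ofReal_cos, ← Complex.ofReal_sin, Real.cos_pi_div_two, Real.sin_pi_div_two]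
  simp

/-- `1/(−iπr) = i/(πr)` for a non-zero real `r`. [folklore] -/
private theorem one_div_neg_I_pi (r : ℝ) (hr : r ≠ 0) : (1 : ℂ) / (-(I * π * r)) = I / (π * r) := by
  have hπ : (π : ℂ) ≠ 0 := by exact_mod_cast Real.pi_ne_zero
  have hr' : (r : ℂ) ≠ 0 := by exact_mod_cast hr
  have h1 : (-(I * π * (r : ℂ))) ≠ 0 := by simp [hπ, hr', Complex.I_ne_zero]
  rw [div_eq_div_iff h1 (mul_ne_zero hπ hr')]
  linear_combination ((π : ℂ) * r) * Complex.I_sq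

/-- `1/(−iπk) = i/(πk)` for a non-zero natural `k`. [folklore] -/
private theorem one_div_neg_I_pi_nat (k : ℕ) (hk : k ≠ 0) : (1 : ℂ) / (-(I * π * k)) = I / (π * k) := by
  have h := one_div_neg_I_pi (k : ℝ) (by exact_mod_cast hk)
  push_cast at h
  exact h

/-- `1/(−iπ(k+1)) = i/(π(k+1))`. [folklore] -/
private theorem one_div_neg_I_pi_nat_succ (k : ℕ) : (1 : ℂ) / (-(I * π * (k + 1))) = I / (π * (k + 1)) := by
  have h := one_div_neg_I_pi ((k : ℝ) + 1) (by positivity)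
  push_cast at h
  exact h

variable (t : ℝ) (k : ℕ)

/-- The edge triple is pairwise distinct when `t ∉ {k, k+1}`. [cite: Zhang2022LandauSiegel, §2 (2.13)] -/
theorem injective_edge (htk : t ≠ k) (htk1 : t ≠ k + 1) :
    Function.Injective (![t, (k : ℝ), (k : ℝ) + 1] : Fin 3 → ℝ) := by
  intro i j hij
  fin_cases i <;> fin_cases j <;>
    simp [Matrix.cons_val_zero, Matrix.cons_val_one, Matrix.cons_val_two, Matrix.head_cons, Matrix.tail_cons]
      at hij ⊢ <;>
    first | exact absurd hij htk | exact absurd hij.symm htk | exact absurd hij htk1 | exact absurd hij.symm htk1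

/-- **The one-sided AFE pair is a NULL PROFILE of `𝔅_{R(t;k,k+1)}` for every `t`:** for `k ≥ 1` and
`t ∉ {0, k, k+1}`, with `h(y) = e^{−iπky} + e^{−iπ(k+1)y}` (`h(1) = 0`, `h(0) = 2`; written with the harmless factors
`c^0 = 1` so that `h′ = c₁e^{c₁y} + c₂e^{c₂y}` is literally the companion derivative),
`Det.FormDet (Det.shiftRecipe (t; k, k+1)) h h′ = 0`. [cite: Zhang2022LandauSiegel, §2 Lemma 2.3, (2.13); Prop 7.1 p. 44] -/
theorem formDet_shiftRecipe_edge_afePair (hk : 1 ≤ k) (ht0 : t ≠ 0) (htk : t ≠ k) (htk1 : t ≠ k + 1) :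
    FormDet (shiftRecipe ![t, (k : ℝ), (k : ℝ) + 1])
        (fun y : ℝ => (-(I * π * k)) ^ 0 * cexp (-(I * π * k) * y)
          + (-(I * π * (k + 1))) ^ 0 * cexp (-(I * π * (k + 1)) * y))
        (fun y : ℝ => (-(I * π * k)) ^ (0 + 1) * cexp (-(I * π * k) * y)
          + (-(I * π * (k + 1))) ^ (0 + 1) * cexp (-(I * π * (k + 1)) * y)) = 0 := by
  set b : Fin 3 → ℝ := ![t, (k : ℝ), (k : ℝ) + 1] with hb_def
  have hb : Function.Injective b := injective_edge t k htk htk1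
  have hkR : (k : ℝ) ≠ 0 := by exact_mod_cast (Nat.one_le_iff_ne_zero.mp hk)
  have hk1R : (k : ℝ) + 1 ≠ 0 := by positivity
  have hb0 : ∀ m, b m ≠ 0 := by
    intro m; fin_cases m <;> simp [hb_def, ht0, hkR, hk1R]
  have hktR : (k : ℝ) - t ≠ 0 := sub_ne_zero.2 (Ne.symm htk)
  have hk1tR : (k : ℝ) + 1 - t ≠ 0 := sub_ne_zero.2 (Ne.symm htk1)
  have htkR : t - k ≠ 0 := sub_ne_zero.2 htk
  have hπ : (π : ℂ) ≠ 0 := by exact_mod_cast Real.pi_ne_zero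
  have hkC : (k : ℂ) ≠ 0 := by exact_mod_cast (Nat.one_le_iff_ne_zero.mp hk)
  have hk1C : ((k : ℂ) + 1) ≠ 0 := by exact_mod_cast Nat.succ_ne_zero k
  -- the pair as the AFE sum with coefficients γ = (0, 1, 1)
  set γ : Fin 3 → ℂ := ![0, 1, 1] with hγ
  set c₁ : ℂ := -(I * π * k) with hc₁
  set c₂ : ℂ := -(I * π * (k + 1)) with hc₂
  have hc₁0 : c₁ ≠ 0 := by rw [hc₁]; simp [hπ, hkC, Complex.I_ne_zero]
  have hc₂0 : c₂ ≠ 0 := by rw [hc₂]; simp [hπ, hk1C, Complex.I_ne_zero]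
  have hsum : ∀ (j : ℕ) (y : ℝ),
      (∑ m : Fin 3, γ m * (-(I * π * (b m : ℂ))) ^ j * cexp (-(I * π * (b m : ℂ)) * y))
        = c₁ ^ j * cexp (c₁ * y) + c₂ ^ j * cexp (c₂ * y) := by
    intro j y
    simp only [Fin.sum_univ_three, hγ, hb_def, hc₁, hc₂, Matrix.cons_val_zero, Matrix.cons_val_one,
      Matrix.cons_val_two, Matrix.head_cons, Matrix.tail_cons, zero_mul, zero_add, one_mul]
    push_cast
    ring_nf
  -- Euler–Lagrange constant for the pair, from `el_afeSum_const`
  have hel : ∀ x ∈ Icc (0:ℝ) 1,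
      -(c₁ ^ 2 * cexp (c₁ * x) + c₂ ^ 2 * cexp (c₂ * x))
        - I * π * (symE1 b) * (c₁ ^ 1 * cexp (c₁ * x) + c₂ ^ 1 * cexp (c₂ * x))
        + (π : ℂ) ^ 2 * (symE2 b) * (c₁ ^ 0 * cexp (c₁ * x) + c₂ ^ 0 * cexp (c₂ * x))
        + I * (π : ℂ) ^ 3 * (symE3 b) * ∫ s in (0:ℝ)..x, (c₁ ^ 0 * cexp (c₁ * s) + c₂ ^ 0 * cexp (c₂ * s))
        = (π : ℂ) ^ 2 * ∑ m : Fin 3, γ m * (shiftN b m : ℂ) := by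
    intro x _
    have h := el_afeSum_const b hb0 γ x
    rw [hsum 2 x, hsum 1 x, hsum 0 x] at h
    rw [show (fun s : ℝ => c₁ ^ 0 * cexp (c₁ * s) + c₂ ^ 0 * cexp (c₂ * s))
        = fun s : ℝ => ∑ m : Fin 3, γ m * (-(I * π * (b m : ℂ))) ^ 0 * cexp (-(I * π * (b m : ℂ)) * s) by
        funext s; exact (hsum 0 s).symm]
    exact h
  -- parity sign and the endpoint values of the exponentials
  set σr : ℝ := (-1 : ℝ) ^ k with hσr
  have hz1 : cexp c₁ = (σr : ℂ) := by rw [hc₁, cexp_neg_I_pi_nat]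
  have hz2 : cexp c₂ = -(σr : ℂ) := by
    rw [hc₂, show -(I * π * ((k : ℂ) + 1)) = -(I * π * k) + -(π * I) by ring, Complex.exp_add, cexp_neg_I_pi_nat,
      ← hσr, Complex.exp_neg, Complex.exp_pi_mul_I]
    norm_num
  have hone : c₁ ^ 0 * cexp (c₁ * (1:ℝ)) + c₂ ^ 0 * cexp (c₂ * (1:ℝ)) = 0 := by
    simp only [pow_zero, one_mul, Complex.ofReal_one, mul_one, hz1, hz2, add_neg_cancel]
  -- the closed form of Part 1
  have hM := mformDet_self_shiftRecipe_of_el (C := (π : ℂ) ^ 2 * ∑ m : Fin 3, γ m * (shiftN b m : ℂ)) hb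
    (isC1_pair c₁ c₂ 0) (isC1_pair c₁ c₂ 1) hone
    (fun x hx => by simpa only [zero_add, one_add_one_eq_two] using hel x hx)
  simp only [zero_add] at hM
  -- endpoint data of the pair
  have h0 : c₁ ^ 0 * cexp (c₁ * (0:ℝ)) + c₂ ^ 0 * cexp (c₂ * (0:ℝ)) = 2 := by simp; norm_num
  have h0' : c₁ ^ 1 * cexp (c₁ * (0:ℝ)) + c₂ ^ 1 * cexp (c₂ * (0:ℝ)) = -(I * π * (2 * k + 1)) := by
    simp [hc₁, hc₂]; ring
  -- ∫₀¹ h = i·ρ with ρ real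
  set ρ : ℝ := (σr - 1) / (π * k) + (-σr - 1) / (π * (k + 1)) with hρ
  have hInt : (∫ x in (0:ℝ)..1, (c₁ ^ 0 * cexp (c₁ * x) + c₂ ^ 0 * cexp (c₂ * x))) = I * (ρ : ℂ) := by
    have i1 : IntervalIntegrable (fun x : ℝ => cexp (c₁ * x)) volume 0 1 :=
      (Complex.continuous_exp.comp (continuous_const.mul Complex.continuous_ofReal)).intervalIntegrable 0 1
    have i2 : IntervalIntegrable (fun x : ℝ => cexp (c₂ * x)) volume 0 1 :=
      (Complex.continuous_exp.comp (continuous_const.mul Complex.continuous_ofReal)).intervalIntegrable 0 1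
    simp only [pow_zero, one_mul]
    rw [intervalIntegral.integral_add i1 i2, integral_exp_mul_complex hc₁0, integral_exp_mul_complex hc₂0]
    simp only [Complex.ofReal_one, mul_one, Complex.ofReal_zero, mul_zero, Complex.exp_zero, hz1, hz2]
    rw [div_eq_mul_one_div ((σr : ℂ) - 1) c₁, div_eq_mul_one_div (-(σr : ℂ) - 1) c₂, hc₁, hc₂,
      one_div_neg_I_pi_nat k (Nat.one_le_iff_ne_zero.mp hk), one_div_neg_I_pi_nat_succ k, hρ]
    push_cast
    ring
  -- u = e^{iπt/2}, conj u = e^{−iπt/2}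
  set u : ℂ := cexp (I * π * (t / 2 : ℂ)) with hu
  have hubar : conj u = cexp (-(I * π * (t / 2 : ℂ))) := by
    rw [hu, ← Complex.exp_conj]
    congr 1
    simp only [map_mul, Complex.conj_I, Complex.conj_ofReal, map_div₀, map_ofNat]
    ring
  -- explicit recipe data at the edge
  have hS : shiftS b = ![2 * (k : ℝ) + 1, (k : ℝ) + 1 + t, t + k] := by
    funext j; fin_cases j
    · simp [shiftS, hb_def]; ring
    · simp [shiftS, hb_def]
    · simp [shiftS, hb_def]
  have hN : shiftN b = ![(k : ℝ) * (k + 1), ((k : ℝ) + 1) * t, t * k] := by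
    funext j; fin_cases j
    · simp [shiftN, hb_def]
    · simp [shiftN, hb_def]
    · simp [shiftN, hb_def]
  have hV : shiftVdm b = ![((k : ℝ) - t) * (k + 1 - t), t - k, -(t - k - 1)] := by
    funext j; fin_cases j
    · simp [shiftVdm, hb_def]
    · simp [shiftVdm, hb_def]
    · simp [shiftVdm, hb_def]; ring
  have hE1 : symE1 b = t + 2 * k + 1 := by simp [symE1, hb_def]; ring
  -- the three phases
  have hph0 : cexp (I * π * (((2 * k + 1 - t) / 2 : ℝ) : ℂ)) = (σr : ℂ) * I * conj u := by
    rw [hubar, show I * π * (((2 * k + 1 - t) / 2 : ℝ) : ℂ) = I * π * (k : ℂ) + I * π * (1 / 2 : ℂ)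
        + -(I * π * (t / 2 : ℂ)) by push_cast; ring, Complex.exp_add, Complex.exp_add, cexp_I_pi_nat, cexp_I_pi_half]
  have hph1 : cexp (I * π * ((((k : ℝ) + 1 + t - k) / 2 : ℝ) : ℂ)) = I * u := by
    rw [hu, show I * π * ((((k : ℝ) + 1 + t - k) / 2 : ℝ) : ℂ) = I * π * (1 / 2 : ℂ) + I * π * (t / 2 : ℂ) by
      push_cast; ring, Complex.exp_add, cexp_I_pi_half]
  have hph2 : cexp (I * π * (((t + k - ((k : ℝ) + 1)) / 2 : ℝ) : ℂ)) = -I * u := by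
    rw [hu, show I * π * (((t + k - ((k : ℝ) + 1)) / 2 : ℝ) : ℂ) = -(I * π * (1 / 2 : ℂ)) + I * π * (t / 2 : ℂ) by
      push_cast; ring, Complex.exp_add, Complex.exp_neg, cexp_I_pi_half, Complex.inv_I]
  -- the channel weights: W_j = (real) · (phase)
  have hW0 : shiftW b 0 = ((t * σr / (((k : ℝ) - t) * (k + 1 - t)) : ℝ) : ℂ) * (I * conj u) := by
    unfold shiftW
    rw [hS, hV]
    simp only [hb_def, Matrix.cons_val_zero]
    rw [hph0]
    have h1 : (((k : ℝ) - t : ℝ) : ℂ) ≠ 0 := by exact_mod_cast hktR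
    have h2 : (((k : ℝ) + 1 - t : ℝ) : ℂ) ≠ 0 := by exact_mod_cast hk1tR
    push_cast at h1 h2 ⊢
    field_simp
  have hW1 : shiftW b 1 = (((k : ℝ) / (t - k) : ℝ) : ℂ) * (I * u) := by
    unfold shiftW
    rw [hS, hV]
    simp only [hb_def, Matrix.cons_val_one, Matrix.cons_val_zero]
    rw [hph1]
    have h1 : ((t - k : ℝ) : ℂ) ≠ 0 := by exact_mod_cast htkR
    push_cast at h1 ⊢
    field_simp
  have htk1R : t - k - 1 ≠ 0 := by intro h; apply htk1; linarith
  have hW2 : shiftW b 2 = ((((k : ℝ) + 1) / (t - k - 1) : ℝ) : ℂ) * (I * u) := by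
    unfold shiftW
    rw [hS, hV]
    simp only [hb_def, Matrix.cons_val_two, Matrix.tail_cons, Matrix.head_cons]
    rw [hph2]
    have h3 : ((t - k - 1 : ℝ) : ℂ) ≠ 0 := by exact_mod_cast htk1R
    push_cast at h3 ⊢
    field_simp
  -- dd-moments = channel sums (distinct triple)
  have hm0 : ddM0 b = shiftW b 0 + shiftW b 1 + shiftW b 2 := by
    rw [← sum_shiftW_eq_ddM0 hb, Fin.sum_univ_three]; rfl
  have hms : ddMs b
      = shiftW b 0 * (shiftS b 0 : ℂ) + shiftW b 1 * (shiftS b 1 : ℂ) + shiftW b 2 * (shiftS b 2 : ℂ) := by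
    rw [← sum_shiftW_s_eq_ddMs hb, Fin.sum_univ_three]; rfl
  have hmn : ddMn b
      = shiftW b 0 * (shiftN b 0 : ℂ) + shiftW b 1 * (shiftN b 1 : ℂ) + shiftW b 2 * (shiftN b 2 : ℂ) := by
    rw [← sum_shiftW_n_eq_ddMn hb, Fin.sum_univ_three]; rfl
  -- real amplitudes: m₀ = i(α₀ ū + β₀ u), m_s = i(α_s ū + β_s u), m_n = i(α_n ū + β_n u)
  set r0 : ℝ := t * σr / (((k : ℝ) - t) * (k + 1 - t)) with hr0
  set r1 : ℝ := (k : ℝ) / (t - k) with hr1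
  set r2 : ℝ := ((k : ℝ) + 1) / (t - k - 1) with hr2
  set q1 : ℝ := -(π ^ 2 * (t * (2 * k + 1)) * ρ) + 2 * π * (2 * k + 1) - 4 * π * (t + 2 * k + 1) with hq1
  set A : ℝ := r0 * q1 + 4 * π * (r0 * (2 * k + 1)) + 2 * π ^ 2 * ρ * (r0 * ((k : ℝ) * (k + 1))) with hA
  set B : ℝ := (r1 + r2) * q1 + 4 * π * (r1 * ((k : ℝ) + 1 + t) + r2 * (t + k))
    + 2 * π ^ 2 * ρ * (r1 * (((k : ℝ) + 1) * t) + r2 * (t * k)) with hB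
  -- the constant C = π²·(n₁ + n₂) = π²·t(2k+1)
  have hC : (π : ℂ) ^ 2 * ∑ m : Fin 3, γ m * (shiftN b m : ℂ) = (π : ℂ) ^ 2 * ((t * (2 * k + 1) : ℝ) : ℂ) := by
    rw [hN]
    simp only [hγ, Fin.sum_univ_three, Matrix.cons_val_zero, Matrix.cons_val_one, Matrix.cons_val_two,
      Matrix.head_cons, Matrix.tail_cons, zero_mul, zero_add, one_mul]
    push_cast; ring
  -- M_b(h,h) = (1/π)·i²·(A·conj u + B·u)
  have hMval : MformDet (shiftRecipe b)
        (fun y : ℝ => c₁ ^ 0 * cexp (c₁ * y) + c₂ ^ 0 * cexp (c₂ * y))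
        (fun y : ℝ => c₁ ^ 1 * cexp (c₁ * y) + c₂ ^ 1 * cexp (c₂ * y))
        (fun y : ℝ => c₁ ^ 0 * cexp (c₁ * y) + c₂ ^ 0 * cexp (c₂ * y))
        (fun y : ℝ => c₁ ^ 1 * cexp (c₁ * y) + c₂ ^ 1 * cexp (c₂ * y))
      = (((1 / π : ℝ)) : ℂ) * (I * I * ((A : ℂ) * conj u + (B : ℂ) * u)) := by
    rw [hM, hC, h0, h0', hInt, hm0, hms, hmn, hW0, hW1, hW2, hS, hN, hE1]
    simp only [Matrix.cons_val_zero, Matrix.cons_val_one, Matrix.cons_val_two, Matrix.head_cons, Matrix.tail_cons,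
      map_mul, Complex.conj_I, Complex.conj_ofReal, map_ofNat, hA, hB, hq1]
    push_cast
    ring
  -- the rational identity A + B = 0 (one per parity of k)
  have hAB : A + B = 0 := by
    have hπR : (π : ℝ) ≠ 0 := Real.pi_ne_zero
    rw [hA, hB, hq1, hr0, hr1, hr2, hρ]
    rcases Nat.even_or_odd k with hev | hodd
    · have hs : σr = 1 := by rw [hσr, hev.neg_one_pow]
      rw [hs]
      field_simp
      ring
    · have hs : σr = -1 := by rw [hσr, hodd.neg_one_pow]
      rw [hs]
      field_simp
      ring
  -- conclude: 𝔅 = 2·Re M = −(2/π)·(A + B)·Re u = 0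
  have hsame : (fun y : ℝ => (-(I * π * k)) ^ 0 * cexp (-(I * π * k) * y)
        + (-(I * π * (k + 1))) ^ 0 * cexp (-(I * π * (k + 1)) * y))
      = (fun y : ℝ => c₁ ^ 0 * cexp (c₁ * y) + c₂ ^ 0 * cexp (c₂ * y)) := rfl
  have hsame' : (fun y : ℝ => (-(I * π * k)) ^ (0 + 1) * cexp (-(I * π * k) * y)
        + (-(I * π * (k + 1))) ^ (0 + 1) * cexp (-(I * π * (k + 1)) * y))
      = (fun y : ℝ => c₁ ^ 1 * cexp (c₁ * y) + c₂ ^ 1 * cexp (c₂ * y)) := rfl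
  rw [hsame, hsame', formDet_eq_two_mul_re, hMval]
  have hB' : (B : ℂ) = -(A : ℂ) := by
    have : B = -A := by linarith
    rw [this]; push_cast; ring
  rw [hB']
  simp only [Complex.mul_re, Complex.mul_im, Complex.I_re, Complex.I_im, Complex.ofReal_re, Complex.ofReal_im,
    Complex.add_re, Complex.add_im, Complex.neg_re, Complex.neg_im, Complex.conj_re, Complex.conj_im]
  ring

/-- **Consequently the E-010 slot cannot hold with a margin on a lattice edge:** at `b = (t; k, k+1)` (`k ≥ 1`,
`t ∉ {0,k,k+1}`) there is a one-sided kinked profile `g` with `g(0) = 2` (so `g ≢ 0`), `g(1) = 0` and `𝔅_{R(b)}(g) = 0`.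
[cite: Zhang2022LandauSiegel, §2 Lemma 2.3, (2.13); Prop 7.1 p. 44] -/
theorem exists_nullProfile_edge (hk : 1 ≤ k) (ht0 : t ≠ 0) (htk : t ≠ k) (htk1 : t ≠ k + 1) :
    ∃ g g' : ℝ → ℂ, KinkedProfile g g' ∧ g 1 = 0 ∧ g 0 = 2 ∧
      FormDet (shiftRecipe ![t, (k : ℝ), (k : ℝ) + 1]) g g' = 0 := by
  refine ⟨fun y : ℝ => (-(I * π * k)) ^ 0 * cexp (-(I * π * k) * y)
      + (-(I * π * (k + 1))) ^ 0 * cexp (-(I * π * (k + 1)) * y),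
    fun y : ℝ => (-(I * π * k)) ^ (0 + 1) * cexp (-(I * π * k) * y)
      + (-(I * π * (k + 1))) ^ (0 + 1) * cexp (-(I * π * (k + 1)) * y),
    kinkedProfile_of_isC1' (isC1_pair _ _ 0), ?_, ?_, formDet_shiftRecipe_edge_afePair t k hk ht0 htk htk1⟩
  · simp only [pow_zero, one_mul, Complex.ofReal_one, mul_one]
    rw [show -(I * π * ((k : ℂ) + 1)) = -(I * π * k) + -(π * I) by ring, Complex.exp_add, cexp_neg_I_pi_nat,
      Complex.exp_neg, Complex.exp_pi_mul_I]
    norm_num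
  · simp; norm_num

end Edge

end Det

end Literature.NumberTheory.LFunctions.Zhang2022
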